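import Literature.Topology.FourManifolds.PlanarLefschetzBodyCounterexample
import Literature.Geometry.Symplectic.PlanarSteinDictionary
import HarnessLib

/-!
# `PlanarAcyclicBisectionRigidity` — negative-side support: the itemised dictionary stub of line `Sketch` v3.0–v3.1 is FALSE as rendered

Support lemma for the crux
`Summit.SmoothPoincare4.SmoothPoincare4.Theses.ConvexBisection.PlanarAcyclicBisectionRigidity`
(stmt-SmoothPoincare4-15086), line `Sketch` (`Cruxes/PlanarAcyclicBisectionRigidity/Lines/Sketch.lean`).

Skeleton v3.0–v3.1 of the line carried ONE dictionary stub, `stub_dictionaryFacts`, the conjunction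
of eleven named Literature facts: F-a `supportedPlanarMonodromy` (`PlanarMonodromy.lean`), the three
contact-topological facts of `PlanarSteinDictionary.lean` (Wendl 2010 Thm 1 for bisections;
Loi–Piergallini / Akbulut–Ozbagci + Gay; Baykur 2006 Thm 5.1) and the seven topological facts of
`PlanarLefschetzBodyFacts.lean` (the `χ` / `H₁` / `π₁` readers, two contractibility readers, move
invariance, the double of a block), all stated over the thin vocabulary `IsPlanarLefschetzBody` /
`IsPlanarWordManifold` (`PlanarLefschetzBody.lean`).  The tree's
`PlanarLefschetzBodyCounterexample.lean` (landed 2026-08-17T09:53Z, two minutes after v3.1 was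
registered) refutes the fifth, sixth and seventh conjuncts: the `IsPageSystem` clause of
`IsLefschetzHandlebodyOver` pins the boundary open book of the base only up to boundary
multitwists, so `𝔻⁴` is a "planar Lefschetz body over `P₁` with no letters" (ℚ-acyclic with
`0 ≠ 1` letters; `H₁ = 0` without generating `F₁ᵃᵇ`) and `S⁴` a "planar word manifold of the empty
word" (simply connected without normally generating `F₁`).

* `helper_dictionaryFacts_false` — the registered conjunction is false (by
  `not_planarLefschetzBody_length_of_acyclic`).  It records, kernel-checked, WHY the line was
  reshaped (v4.0: the dictionary is now ONE stub stated by its use, in the crux's vocabulary and the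
  word calculus only), so that no continuation re-registers the itemised stub over that vocabulary.

Nothing here bears on the crux itself (the printed theorems behind the eleven facts are true of
the honest `X(P_n; w)`); it bears on the tree's rendering of "`X` is `X(P_n; w)`".
-/

noncomputable section

open Literature.Geometry.Symplectic Literature.Topology.FourManifolds
open Literature.Topology.FourManifolds.PlanarWords

-- the prescribed namespace `Summit.<S>.<P>.…` repeats `SmoothPoincare4` (S = P = SmoothPoincare4)
set_option linter.dupNamespace false

namespace Summit.SmoothPoincare4.SmoothPoincare4.Theorems.PlanarAcyclicBisectionRigidity.Sketch

/-- **The itemised dictionary stub of line `Sketch` v3.0–v3.1 is false as rendered**: its fifth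
conjunct `planarLefschetzBody_length_of_acyclic` ("a ℚ-acyclic planar Lefschetz body over `P_n` has
`n` letters", over the thin vocabulary `IsPlanarLefschetzBody`) is refuted in the tree by
`Literature.Topology.FourManifolds.not_planarLefschetzBody_length_of_acyclic` (`𝔻⁴` is a planar
Lefschetz body over `P₁` with `0 ≠ 1` letters, the page-system clause of
`IsLefschetzHandlebodyOver` not pinning the boundary monodromy of the base); so are the sixth and
seventh (`not_planarLefschetzBody_unimodular_of_isZero_H1`,
`not_planarWordManifold_normallyGenerates_of_simplyConnected`).  The registered signature of the
expired stub, negated. [folklore] -/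
theorem helper_dictionaryFacts_false :
    ¬ (supportedPlanarMonodromy ∧ wendl_planarSteinBisection ∧ planarLefschetzBody_stein_supported ∧
      baykur_planarSteinBisection ∧ planarLefschetzBody_length_of_acyclic ∧
      planarLefschetzBody_unimodular_of_isZero_H1 ∧
      planarWordManifold_normallyGenerates_of_simplyConnected ∧ planarLefschetzBody_contractible ∧
      planarLefschetzBody_contractible_of_isDouble ∧ planarWordManifold_move_iff ∧
      planarWordManifold_isDouble_of_twistEq) :=
  fun h => not_planarLefschetzBody_length_of_acyclic h.2.2.2.2.1

/-- The three refuted conjuncts, separately (the other eight are not claimed either way here: for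
the thin reading the hypothesis-side facts F-c, F-S, readers 4–5, F-M, F-D are suspect by the same
mechanism, while F-a and Wendl's conclusion-side fact are merely weaker than the printed theorems).
[folklore] -/
theorem helper_dictionaryFacts_refuted_conjuncts :
    ¬ planarLefschetzBody_length_of_acyclic ∧ ¬ planarLefschetzBody_unimodular_of_isZero_H1 ∧
      ¬ planarWordManifold_normallyGenerates_of_simplyConnected :=
  ⟨not_planarLefschetzBody_length_of_acyclic, not_planarLefschetzBody_unimodular_of_isZero_H1,
    not_planarWordManifold_normallyGenerates_of_simplyConnected⟩

end Summit.SmoothPoincare4.SmoothPoincare4.Theorems.PlanarAcyclicBisectionRigidity.Sketch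

end
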